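import Summits.NavierStokesRegularity.NavierStokesRegularity.Theses.SymmetryModuliCount
import Literature.Analysis.FluidPDE.TypeIAncientMild
import Literature.Analysis.FluidPDE.KatoSymmetryCovariance
import Literature.Analysis.FluidPDE.KNSSOseenMildDecayTools
import Literature.Analysis.FluidPDE.KNSSLiouville
import Literature.Analysis.FluidPDE.PineauVicolRSS
-- landed Negative lemmas of this crux (`symmetricLiouville_false_without_typeI/_without_mild/_with_bounded`,
-- `_typeI_near_zero_bounded_past`, `_mild_on_window`, `_on_window`), imported so that this scratch check sees
-- them next to the stubs: every stub below keeps the FULL class `IsTypeIAncientMild C u` (Type-I decay back to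
-- −∞ AND the Oseen identity back to −∞, on the whole past), so none is an instance of a refuted mutant.
import Summits.NavierStokesRegularity.NavierStokesRegularity.Theorems.SymmetricLiouville.Negative.LoadBearing
import HarnessLib.Audit

/-!
# Skeleton line `farfield-recentring-critical-rate` for crux `SymmetricLiouville` (stmt-NavierStokesRegularity-4053)

Route `SymmetryModuliCount`, sub-problem `NavierStokesRegularity` (Clay A, positive side). Crux-plan skeleton
(planner `cruxplan-stmt-NavierStokesRegularity-4053-farfield-recentring-`, round 1) of the crux idea card
`Cruxes/SymmetricLiouville/Ideas/farfield-recentring-critical-rate.md` (ideator 2; first lemmas typed in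
`Cruxes/SymmetricLiouville/SketchIdeator2.lean`: `FarFieldVanishing`, `AxisymmetricAxisRate`,
`SpiralScalingSpaceTimeRate`, `AxisymmetricLeaf`), with the panel notes `TRIAGE-r1-{1,2,3}.md` (pass ×3) and
the standing disprover's `Disproof.lean` v7 (cycle-2 stub audit) acted on.

## The crux

`SymmetricLiouville`: every `u` in the Type-I KNSS-mild ancient class `A_C` (`IsTypeIAncientMild C u`,
definitionally the four clauses of the decl, `isTypeIAncientMild_iff`) annihilated by the generator
`L_ξ u = ∇u·(a + σx + Ax) + σu + 2σt ∂_t u − Au` of a nonzero `ξ = (a, σ, A) ∈ sim(3)` (`A` skew) vanishes.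

## The lever of this line: ONE object, the scale-invariant far-field envelope, and TWO moves on it

`e(ρ) := sup { √(−t)‖u(t,x)‖ : ‖σx + Ax‖ ≥ ρ√(−t)(|σ| + ‖A‖) }` for an element of `A_C` annihilated by a centred
generator `ξ = (0, σ, A)` — `{σx + Ax = 0}` is the centre `{0}` of a spiral scaling (`σ ≠ 0`) or the axis `ker A`
of a rotation (`σ = 0 ≠ A`), and `‖σx + Ax‖² = σ²‖x‖² + ‖Ax‖²`, `‖Ax‖ = ‖A‖·dist(x, ker A)` (skewness).
(B1, RECENTRING — `stub_farFieldVanishing`) `e(ρ) → 0` as `ρ → ∞`, UNIFORMLY over the class and the generator: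
translating `u` to a far point `y` keeps it in `A_C` but turns the generator into `((σ + A)y, σ, A)`; after
division by `‖(σ + A)y‖ ≥ ρ(|σ| + ‖A‖)√(−t)` the `σ`-, `A`- and `2σt∂_t`-parts carry a factor `≤ 1/ρ → 0` against
locally bounded `u, ∇u, ∂_t u` (KNSS §4 bounds, uniform on the class), so every far-field limit (compactness +
mild closure of `A_C`, "F3") is a NONZERO element of `A_C` invariant under a pure TRANSLATION — impossible by the
PROVED tree theorem `KNSS2009_typeI_rate_liouville_holds` (KNSS Thm 5.1 + Rem. 6.1 + caloric Liouville). The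
threshold is deliberately ANISOTROPIC (`|σ| + ‖A‖` on the left): this is what makes the statement uniform with no
case split (triage r1-1 S5, r1-2, r1-3) and immune to the disprover's cycle-2 UNIFORMITY GAP (Disproof.lean §(ii):
with an isotropic threshold, far points on the axis of a fast rotation produce ROTATION-symmetric limits) — here
`‖A_n‖/‖(σ_n + A_n)y_n‖ ≤ 1/ρ_n → 0` always. The price is paid downstream and is affordable: for a spiral scaling
with fast rotation the smallness region also excludes a parabolic tube about the rotation axis, so the
bootstrap constants below depend on `‖A‖/|σ|` (allowed: `∃ R`, `∃ K` are per `(u, A)`).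
(B2, OSEEN BOOTSTRAP — `stub_axisOseenBootstrap` (axis geometry) and `stub_oseenBootstrap` (point geometry)):
SYMMETRY-FREE. In the ancient Oseen identity `u(t) = −∫_{−∞}^t e^{(t−τ)Δ}P∇·(u⊗u) dτ` (free term killed by the
decay at `−∞`; the gauge back to `−∞`) split the sources into the parabolic CORE (tube `dist ≤ R√(−τ)` resp. ball
`‖y‖ ≤ R√(−τ)`), which acts as a regular source of strength `C²/(−τ)` radiating exactly the `1/dist` law
(`|K(τ,z)| ≤ C₀(τ + |z|²)^{-2}` = tree `exists_norm_oseenKernel_le`; tube: `∫dz′((L/2)² + z′²)^{-2} = cL^{-3}`,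
angular integral `2π(1+ϱ²)^{-1/2}`), and the exterior, which is QUADRATIC in the envelope at smaller arguments:
master inequality `m(L) ≤ K₁ m(L/4)² + (K₂/L)∫₀ᴸ m² + K₃C²/L` with NO logarithm in either geometry (re-derived term
by term by triage r1-1 S6, r1-2 §C + kit j010063, r1-3; self-consistency: `m = c/L` reproduces itself,
`m = L^{-p}` (`p < 1`) and `1/log L` violate it); `m → 0` (B1) absorbs the quadratic terms and two stages (power
rate, exponent doubling) give the CRITICAL RATE `m(L) ≤ K/L`.
WHY IT BITES: `1/dist` is LITERALLY the missing hypothesis of the two theorems on these leaves —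
(R₀) axisymmetric with swirl: `dist(x, axis)·‖u‖ ≤ K` is `|u| ≤ K/r`, the hypothesis of KNSS 2009 Thm 5.3, PROVED
in the tree (`KNSS2009_liouville_bound_C_over_r_holds`) — `stub_axisymmetricLeafOfRate` transports it to the gauge
class; this answers the route-review Objection 1 (with-swirl leaf unbudgeted for abstract `A_C`: SS2009 Prop 3.7
needs the local energy class, KNSS Thm 6.2 ASSUMES the far-field `C/|x′|` bound) with no energy class, no
ε-regularity, no doubling lemma;
(D_α) spiral scaling: `‖u‖ ≤ K/(‖x‖ + √(−t))` is Pineau–Vicol's (1.10) = tree `HasTypeIDecay K u`, so the crux's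
BOUNDED-profile rotated-self-similar row moves into PV's DECAYING class: `α = 0` is Tsai (tree
`tsai_selfsimilar_bounded_holds`, `stub_selfSimilarLeaf`), `|α| < α₁(K)` or `> α₂(K)` is PV Thm 1.4 (named fact
`pineauVicol2026_rss_liouville`), and what is left of the whole crux is ONE named open problem in its natural
class, `stub_rotatedSelfSimilarDecayingLiouville` = `Disproof.RotatedSelfSimilarLiouvilleDecaying` = PV Conj 1.1 =
Tsai 2018 Conj 8.9 on the window `α₁ ≤ |α| ≤ α₂`.

## Shape (6 registered stubs + the route item `HelicalEndLiouville` as hypothesis)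

Up to conjugation by translations (PROVED here, `isTypeIAncientMild_comp_add_right`) and `ξ ↦ ξ/σ`:
* `σ = 0`, `a ∉ range A` (translation or NONZERO-pitch screw): the route's own item `HelicalEndLiouville`
  (stmt-14062, crux r7; sibling lines `degenerate-stabiliser-zoom` stub H, cards blowdown-kills-pitch /
  screw-lattice-blowdown) — taken as the HYPOTHESIS `hH` of `SymmetricLiouville_of`, not re-stubbed here.
* `σ = 0`, `a = Ac` (rotation about the axis `−c + ker A`, swirl allowed): translate the axis through `0`, then
  `stub_farFieldVanishing` (σ = 0) → `stub_axisOseenBootstrap` → `stub_axisymmetricLeafOfRate`; composed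
  sorry-free as `rotationLeaf_of_stubs`, and — BONUS — as a proof BY NAME of the route item `AxisymEndLiouville`
  (stmt-14061, crux r4): `axisymEndLiouville_of` (end-to-past reduction `vanishesOnEnd_of_vanishesOnPast`).
* `σ ≠ 0`: translate to the centre (`exists_spiral_centre`), divide by `σ`; `A/σ = 0` ⇒ `stub_selfSimilarLeaf`
  (Tsai, KNOWN); `A/σ ≠ 0` ⇒ `stub_farFieldVanishing` (σ = 1) → `stub_oseenBootstrap` →
  `stub_rotatedSelfSimilarDecayingLiouville`.
Stubs 5–7 are stated IDENTICALLY to the sibling line `degenerate-stabiliser-zoom` (`stub_oseenBootstrap`,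
`stub_selfSimilarLeaf`, `stub_rotatedSelfSimilarDecayingLiouville`), so one proof closes both lines there; what
THIS line adds is the cut of the axisymmetric leaf down to the PROVED KNSS 5.3 (stubs 2–4 replace the sibling's
opaque `stub_axisymEndLiouville`) and the uniform two-geometry B1.

## Disproof used (`Cruxes/SymmetricLiouville/Disproof.lean` v7 + landed `Theorems/SymmetricLiouville/Negative/*`)

`_false_without_typeI` / `_false_typeI_near_zero_bounded_past`: the DECAY AT −∞ is used by stub 2 (recentred
limits are Type-I translation-invariant elements; constants are excluded only by the decay; rescaling to `t = −1`
uses scale-invariance of `HasTypeITimeDecay`) and by stubs 3, 5 (free term `e^{(t−s)Δ}u(s) → 0` as `s → −∞`;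
`‖u‖ ≤ C/√(−τ)` in the core and the far past); `_false_without_mild` / `_false_mild_on_window`: the Oseen identity
BACK TO −∞ is stubs 3, 5 themselves, is used in stub 2 (mild closure of limits) and in stub 6 (the parasitic
`c/√(−t)` solves the scaling symmetry with Type-I rate; only the gauge kills it, `eq_zero_of_slice_const`);
`_false_on_window` (shear wave): stubs 2, 3, 5 integrate from `τ = −∞` and are void on windows by design;
`_false_with_bounded`: stub 4 applies KNSS 5.3 to bounded SHIFTS `u(·−δ)` but its hypothesis (the rate `K/r`)
comes from stubs 2–3, which need the Type-I class. Cycle 2: §(d) un-witnessability (every stub over `A_C` can only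
fail on a nonzero element of `A_C`) — accepted, the stubs are checked for internal consistency instead (each is
Sim(3)/scaling-invariant as stated and holds for `u = 0`); §(ii) UNIFORMITY GAP — answered by the anisotropic
threshold of stub 2 and by `∃ R, ∃ K` per `(u, A)` in stubs 3, 5 (no uniformity in the rotation rate is claimed);
§(f) `isAxisymmetric_of_clause` / `InClass.isAxisymmetric_of_hasSymmetry_rot` — exactly the integration step
stub 4 needs (after conjugating `ker A` onto the `e₃`-axis). Negatives index (stmt-4055 `FiniteTangentModuli`,
stmt-0154): untouched — no stub is a linearised/tangent count.
-/

noncomputable section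

set_option linter.dupNamespace false

open Set Function
open scoped InnerProductSpace RealInnerProductSpace
open Literature.Analysis.FluidPDE
open Summit.NavierStokesRegularity.NavierStokesRegularity.Theses.SymmetryModuliCount

namespace Summit.NavierStokesRegularity.NavierStokesRegularity.Cruxes.SymmetricLiouville.FarfieldRecentringCriticalRate

/-! ## B1 — far-field recentring (one stub, both geometries, uniform) -/

/-- **Stub 2 (B1) — far-field vanishing by recentring, uniform over the class and the generator** (card B1 =
`SketchIdeator2.FarFieldVanishing` over `IsTypeIAncientMild`; merge group: `stabiliser-at-infinity-decay` Lemma A,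
`degenerate-stabiliser-zoom` L1.5/L1.7; size M given the shared compactness helper F3).  For every `C` and
`ε > 0` there is `ρ` such that every `u ∈ A_C` annihilated by a CENTRED generator `ξ = (0, σ, A)` (`A` skew,
`(σ, A) ≠ 0`: a spiral scaling about the space–time origin, or a rotation about the axis `ker A`) satisfies
`√(−t)‖u(t,x)‖ ≤ ε` wherever `‖σx + Ax‖ ≥ ρ√(−t)(|σ| + ‖A‖)`.  Proof plan (triage r1-1 S5, r1-2, r1-3, all "no
case split"): if not, pick violators `(u_n, σ_n, A_n, t_n, x_n)`; rescale each to `t_n = −1` (the class, the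
clause and the threshold are invariant under `u ↦ λu(λ²t, λx)`, which commutes with `(0, σ, A)`); translate `x_n`
to `0` (`isTypeIAncientMild_comp_add_right`): the generator becomes `(a_n, σ_n, A_n)`, `a_n = σ_n x_n + A_n x_n`,
`|a_n| ≥ ρ_n(|σ_n| + ‖A_n‖)`, `ρ_n → ∞`; divide the clause by `|a_n|`: the coefficients of `x·∇v_n + v_n`, of
`A_n x·∇v_n − A_n v_n` and of `2t∂_t v_n` are `≤ 1/ρ_n`, `≤ 1/ρ_n`, `≤ 2|t|/ρ_n`, against `v_n, ∇v_n, ∂_t v_n`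
bounded on compacts of `t < 0` uniformly in `n` (KNSS Prop 4.1-type bounds for the class:
`knss2009_local_smoothing_holds`); F3 (Arzelà–Ascoli + dominated convergence in the Oseen identity,
`exists_norm_oseenKernel_le`) gives a limit `v ∈ A_C` with `‖v(−1, 0)‖ ≥ ε` and `â·∇v ≡ 0` for a unit vector
`â` — contradicting the translation leaf `KNSS2009_typeI_rate_liouville_holds` (applied to `v(·−δ)` after
rotating `â` onto `e₁`).  The statement is invariant under `ξ ↦ λξ`, so effectively `(σ, A)` ranges over a
sphere: uniformity in the generator costs nothing.  Degenerate instances: `C < 0` ⇒ class empty; `u = 0` fine;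
`σ = 0 = A` excluded (it would assert X). -/
theorem stub_farFieldVanishing :
    ∀ C : ℝ, ∀ ε > 0, ∃ ρ : ℝ,
      ∀ (u : ℝ → EuclideanSpace ℝ (Fin 3) → EuclideanSpace ℝ (Fin 3)) (σ : ℝ)
        (A : EuclideanSpace ℝ (Fin 3) →L[ℝ] EuclideanSpace ℝ (Fin 3)),
        IsTypeIAncientMild C u → (∀ x, inner ℝ (A x) x = 0) → ¬ (σ = 0 ∧ A = 0) →
        (∀ t < 0, ∀ x, fderiv ℝ (u t) x (σ • x + A x) + σ • u t x +
            (2 * σ * t) • timeDeriv u t x - A (u t x) = 0) →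
        ∀ t < 0, ∀ x, ρ * Real.sqrt (-t) * (|σ| + ‖A‖) ≤ ‖σ • x + A x‖ →
          Real.sqrt (-t) * ‖u t x‖ ≤ ε := by
  sorry

/-! ## B2 — the Oseen bootstrap in the two geometries (symmetry-free) -/

/-- **Stub 3 (B2, axis geometry) — the Oseen bootstrap about a LINE: `o(1/√(−t))` outside parabolic tubes ⇒
`dist(x, axis)·‖u‖ ≤ K`** (card B2 / `AxisymmetricAxisRate` with the symmetry stripped off; `stabiliser-at-infinity`
Lemma B-axis = `rMulNorm_bounded_of_screw`; size L).  SYMMETRY-FREE: if `u ∈ A_C` and `√(−t)‖u(t,x)‖ → 0` as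
`‖Ax‖/(‖A‖√(−t)) → ∞` (`A ≠ 0` skew, so `‖Ax‖ = ‖A‖·dist(x, ker A)`: smallness outside parabolic tubes around the
line `ker A`), then `‖Ax‖·‖u(t,x)‖ ≤ K‖A‖`, i.e. `dist(x, ker A)·‖u‖ ≤ K`, for all `t < 0`, `x`.  Proof plan: inside
the tube `dist ≤ R₀√(−t)` the bound is free (`dist·‖u‖ ≤ R₀C`); outside, let `s → −∞` in the Oseen identity (free
term `≤ C/√(−s) → 0`, Duhamel term absolutely convergent: `exists_lintegral_enorm_oseenKernel_le`) and estimate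
`u(t,x) = −∫_{−∞}^t∫K(t−τ, x−y)[u⊗u](τ,y)dydτ` at `dist(x)/√(−t) = L` with
`m(L) := sup{√(−t)‖u(t,x)‖ : dist(x, ker A) ≥ L√(−t)}`: the tube core `{dist(y) ≤ (L/4)√(−τ)}` (density `C²/(−τ)`,
kernel `C₀(τ′ + |z|²)^{-2}` = `exists_norm_oseenKernel_le`, axial integral `∫dz′((L/2)² + z′²)^{-2} = cL^{-3}` per
unit time for recent `τ`, `‖K(τ′)‖₁ ≲ τ′^{-1/2}` once the tube has swallowed `x`) gives `K₃C²/L`; the exterior is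
quadratic in `m`: far region `K₁m(L/4)²` (`∫_{−∞}^t(t−τ)^{-1/2}(−τ)^{-1}dτ = π/√(−t)`), intermediate shells
`(K₂/L)∫₀ᴸm²` (substitution `τ′^{-3/2}dτ′ = (2/L)ds`, line integral `(π/2)(½ + y_⊥²)^{-3/2}`, angular integral
`2π(1 + ϱ²)^{-1/2} ≤ 2π`) — master inequality `m(L) ≤ K₁m(L/4)² + (K₂/L)∫₀ᴸm² + K₃C²/L` with NO logarithm (the
card's own falsifier (i) "tube term degrades to `log ρ/ρ`" does NOT fire: triage r1-1 S6 / Appendix K3–K7, r1-2 §C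
+ j010063 T2e, r1-3 I10–I11); `m(L) → 0` (hypothesis) absorbs the quadratic terms, Stage 1 gives a power rate,
Stage 2 doubles the exponent to `m(L) ≤ K/L`.  `K` may depend on `u` (through the modulus `R(ε)`), which is all
the composition needs; with stub 2's uniform modulus it is `K(C)`. -/
theorem stub_axisOseenBootstrap :
    ∀ (C : ℝ) (u : ℝ → EuclideanSpace ℝ (Fin 3) → EuclideanSpace ℝ (Fin 3))
      (A : EuclideanSpace ℝ (Fin 3) →L[ℝ] EuclideanSpace ℝ (Fin 3)),
      IsTypeIAncientMild C u → (∀ x, inner ℝ (A x) x = 0) → A ≠ 0 →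
      (∀ ε > 0, ∃ R : ℝ, ∀ t < 0, ∀ x, R * Real.sqrt (-t) * ‖A‖ ≤ ‖A x‖ →
          Real.sqrt (-t) * ‖u t x‖ ≤ ε) →
      ∃ K : ℝ, ∀ t < 0, ∀ x, ‖A x‖ * ‖u t x‖ ≤ K * ‖A‖ := by
  sorry

/-- **Stub 5 (B2, point geometry) — the Oseen bootstrap about a POINT: `o(1/√(−t))` outside paraboloids ⇒ the
space–time Type-I bound `‖u(t,x)‖ ≤ K/(‖x‖ + √(−t))`** (card B2 / `SpiralScalingSpaceTimeRate` with the symmetry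
stripped off; IDENTICAL statement to `degenerate-stabiliser-zoom.stub_oseenBootstrap` — one proof closes both;
size L).  Conclusion `HasTypeIDecay K u` is Pineau–Vicol (1.10) ⇔ (1.9) verbatim in tree vocabulary (the hypothesis
class of `pineauVicol2026_rss_liouville` and of Tsai's `L^q`, `q > 3`).  Proof plan: the point version of stub 3 —
core = paraboloid `‖y‖ ≤ (L/4)√(−τ)` of mass `C²(−τ)^{1/2}`, which radiates
`∫C²(−τ)^{1/2}((t−τ) + |x|²)^{-2}dτ ~ C²/(L√(−t))` at `|x| = L√(−t)`, i.e. exactly the `1/|x|` law of Leray / RSS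
profiles; same far and intermediate regions, constants `c₃ = ∫(1+|z|²)^{-2} = π²`, `∫₁^∞dv/(v√(v−1)) = π`;
master inequality without logarithm; two stages; inside the paraboloid `‖u‖ ≤ C/√(−t)` completes
`HasTypeIDecay (K + C)`.  DSS/`L^p` analogue in print: Chae–Wolf 2017 Thm 1.1.  No LOCAL version can hold
(`u = c/√(−t)`, `p = −c·x/(2(−t)^{3/2})` solves NS in `B₁ × (−1,0)` with tiny Type-I constant and blows up at
`t = 0`; cf. `Barriers…InstantaneousTypeIBlowup`) — the GLOBAL ancient identity is essential, and is available
exactly because the class reaches back to `−∞` (Disproof `_false_mild_on_window`, `_false_on_window`). -/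
theorem stub_oseenBootstrap :
    ∀ (C : ℝ) (u : ℝ → EuclideanSpace ℝ (Fin 3) → EuclideanSpace ℝ (Fin 3)),
      IsTypeIAncientMild C u →
      (∀ ε > 0, ∃ R : ℝ, ∀ t < 0, ∀ x, R * Real.sqrt (-t) ≤ ‖x‖ → Real.sqrt (-t) * ‖u t x‖ ≤ ε) →
      ∃ K : ℝ, HasTypeIDecay K u := by
  sorry

/-! ## The endgames: KNSS Thm 5.3 (PROVED), Tsai (PROVED), Pineau–Vicol Conj 1.1 (the residual) -/

/-- **Stub 4 (endgame R₀) — KNSS 2009 Theorem 5.3 in the gauge class, any axis through the origin** (card: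
"the rate is LITERALLY the missing hypothesis of KNSS 5.3"; `SketchIdeator2.AxisymmetricLeaf` +
`AxisymmetricAxisRate`, `stabiliser-at-infinity.axisymmetric_leaf`, `swirl-barrier-past.AxisymmetricLeafOfCOverR`;
size M; KNOWN theorem + bridges).  If `u ∈ A_C` is annihilated by the rotation generator of a nonzero skew `A`
(`∇u·Ax − Au = 0`: rotations about the axis `ker A` through `0`, swirl allowed) AND obeys the rate
`‖Ax‖·‖u(t,x)‖ ≤ K‖A‖` (`= K·dist(x, ker A)^{-1}` bound, the output of stub 3), then `u ≡ 0`.  Proof plan: (i)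
normal form — `A = ω·Rᵀ J R` with `R ∈ SO(3)`, `ω = ‖A‖ > 0`, `J = rotGenL` (spectrum `{0, ±iω}`), and
`A_C` is `O(3)`-covariant (`u ↦ R u(t, Rᵀ·)`: the heat kernel and `oseenKernel` are isometry-equivariant; shared
helper with the helical item 14062), so WLOG `A = ωJ`, axis `e₃`, and the rate reads `cylRadius x * ‖u t x‖ ≤ K`;
(ii) the infinitesimal clause integrates to `IsAxisymmetric (u t)` for every `t < 0` — kernel-checked by the
disprover, `Disproof.isAxisymmetric_of_clause` / `InClass.isAxisymmetric_of_hasSymmetry_rot` (§(f), proposed as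
`Negative.ScrewClause`); (iii) for `δ > 0` the shift `w = u(·−δ)` is in `A_C` (`IsTypeIAncientMild.comp_sub_right`),
BOUNDED by `C/√δ` (`.isBoundedOn`), continuous (`.continuousOn_uncurry`), weakly divergence free
(`.isWeaklyDivFree`) and Oseen-mild in the `heatExtension` rendering (`.mild_eq_heatExtension`), hence a bounded
weak solution on `ℝ³ × (−∞,0)` in KNSS's class by the PROVED tree bridge `isBoundedWeakNSSolutionOn_of_oseen`
(KNSSTypeIRateLiouvilleMild; alternatively `.isBoundedAncientMildSolution_sub`), axisymmetric, with `r‖w‖ ≤ K`;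
(iv) KNSS Thm 5.3 = PROVED tree theorem `KNSS2009_liouville_bound_C_over_r_holds` (`.of_pointwise`) gives
`w(t,·) = 0` a.e. for a.e. `t < 0`, hence everywhere by continuity; `δ ↓ 0`.  This is the with-swirl
axisymmetric Liouville theorem behind `Barriers…AxisymmetricTypeIExclusion`, reached WITHOUT the local energy
class (SS2009 Prop 3.7) and without KNSS Thm 6.2's far-field assumption — both replaced by stubs 2–3. -/
theorem stub_axisymmetricLeafOfRate :
    ∀ (C K : ℝ) (u : ℝ → EuclideanSpace ℝ (Fin 3) → EuclideanSpace ℝ (Fin 3))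
      (A : EuclideanSpace ℝ (Fin 3) →L[ℝ] EuclideanSpace ℝ (Fin 3)),
      IsTypeIAncientMild C u → (∀ x, inner ℝ (A x) x = 0) → A ≠ 0 →
      (∀ t < 0, ∀ x, fderiv ℝ (u t) x (A x) - A (u t x) = 0) →
      (∀ t < 0, ∀ x, ‖A x‖ * ‖u t x‖ ≤ K * ‖A‖) →
      ∀ t < 0, ∀ x, u t x = 0 := by
  sorry

/-- **Stub 6 (endgame D₀) — the self-similar leaf: a backward self-similar element of `A_C` vanishes** (Tsai
1998 Thm 1, `q = ∞`, in the gauge class; IDENTICAL statement to `degenerate-stabiliser-zoom.stub_selfSimilarLeaf`;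
size M, KNOWN).  If `u ∈ A_C` is annihilated by the pure scaling generator about the space–time origin,
`x·∇u + u + 2t∂_t u = 0`, then `u ≡ 0`.  Proof plan: the clause integrates to `u(t,x) = (−t)^{-1/2}U(x/√(−t))`
with `U = u(−1,·)` smooth, divergence free and BOUNDED by `C`; with the KNSS pressure
(`IsTypeIAncientMild.exists_isClassicalNSSolutionOn_Ioo`) `(U, P)` is a Leray profile (`IsLerayProfile`), so
`tsai_selfsimilar_bounded_holds` (PROVED) makes `U` constant; constant slices are killed by the gauge,
`IsTypeIAncientMild.eq_zero_of_slice_const` (KNSS Rem 6.1) — exactly where `Disproof.symmetricLiouville_false_without_mild`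
bites (the parasitic `c/√(−t)` solves the clause and is Type I).  Nearest tree form:
`pineauVicol2026_rss_liouville_alpha_zero`.  (The card would also route this leaf through B1 → B2 → NRŠ/PV since
the profile then decays; kept direct because it is closable today.) -/
theorem stub_selfSimilarLeaf :
    ∀ (C : ℝ) (u : ℝ → EuclideanSpace ℝ (Fin 3) → EuclideanSpace ℝ (Fin 3)),
      IsTypeIAncientMild C u →
      (∀ t < 0, ∀ x, fderiv ℝ (u t) x x + u t x + (2 * t) • timeDeriv u t x = 0) →
      ∀ t < 0, ∀ x, u t x = 0 := by
  sorry

/-- **Stub 7 (endgame D_α, the residual; HARDEST) — rotated self-similar Liouville with SPACE–TIME Type-I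
profile, every rotation rate** (= `Disproof.RotatedSelfSimilarLiouvilleDecaying` unbundled; IDENTICAL statement to
`degenerate-stabiliser-zoom.stub_rotatedSelfSimilarDecayingLiouville`; X-strength on its leaf).  If `u ∈ A_C` also
obeys `‖u(t,x)‖ ≤ K/(‖x‖ + √(−t))` (the output of stubs 2 + 5) and is annihilated by `∇u·(x + Ax) + u + 2t∂_t u
− Au = 0` with `A ≠ 0` skew — so `u` is Pineau–Vicol's ansatz (1.7), `pvAnsatz` with `α = ‖A‖/2` about `ker A`,
with a `C^∞` profile decaying like `1/|y|` — then `u ≡ 0`.  Status: PROVED for `|α| < α₁(K)` and `|α| > α₂(K)`,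
Pineau–Vicol 2026 Thm 1.4 = named tree fact `pineauVicol2026_rss_liouville` (hypothesis (1.10) on `[−1,0)` IS
`HasTypeIDecay`; classical pair from the gauge as in stub 6; conjugate `ker A` onto `e₃` as in stub 4); OPEN on
the compact window `α₁(K) ≤ |α| ≤ α₂(K)` = PV Conjecture 1.1 = Tsai 2018 Conj 8.9 (Perelman) = BT2017 OP 5.2.
The crux implies this stub (`Disproof.symmetricLiouville_implies_rss_decaying`), so nothing weaker can stand here;
a nonzero window profile refutes the stub, the crux, X and the route (KILL CRITERIA (2)).  What stubs 2 + 5 buy: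
PV Lemma 2.1 (α-uniform `C¹, C²` bounds, pressure decay), the bounded Bernoulli function, the positive
adjoint-kernel weight with Gaussian bounds (PV Prop 5.1), the α-independent enstrophy criterion PV Prop 3.1, CKN
and Tsai Thm 2 — none of which sees a merely bounded profile.  Necessary condition for a window profile on record:
`∫(|Ω − αe₃|² − α²)w_α = 0`, chirality `sign(α)∫Ω₃w_α > 0` (card spiral-weight-killing-pairing; this card's
§Barriers: the constant `α²` is a Fredholm obstruction, the window needs a genuinely new input).  Caveat kept from
triage: with `K = K(u, A)` the thresholds `α₁,₂(K)` depend on the rate, so "extreme α" is per-profile information,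
not a uniform sub-window. -/
theorem stub_rotatedSelfSimilarDecayingLiouville :
    ∀ (C K : ℝ) (u : ℝ → EuclideanSpace ℝ (Fin 3) → EuclideanSpace ℝ (Fin 3))
      (A : EuclideanSpace ℝ (Fin 3) →L[ℝ] EuclideanSpace ℝ (Fin 3)),
      IsTypeIAncientMild C u → HasTypeIDecay K u →
      (∀ x, inner ℝ (A x) x = 0) → A ≠ 0 →
      (∀ t < 0, ∀ x, fderiv ℝ (u t) x (x + A x) + u t x + (2 * t) • timeDeriv u t x - A (u t x) = 0) →
      ∀ t < 0, ∀ x, u t x = 0 := by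
  sorry

/-! ## Sorry-free helpers: conjugation by translations, the spiral centre, skew geometry -/

/-- **`A_C` is invariant under space translations** `u ↦ u(·, · + c)` (same constant): smoothness and the
divergence condition are translation covariant (`fderiv_comp_add_right`, tree `IsDivFree.comp_add_right`), the heat
flow and the Oseen–Duhamel term commute with translations (tree `heatFlow_comp_add_right`,
`oseenDuhamel_comp_add_right`), and the Type-I bound is uniform in `x` (KNSS 2009 §1).  Same proof as in the sibling
line `degenerate-stabiliser-zoom` (shared helper; the lead lands it once with `--supports`). -/
theorem isTypeIAncientMild_comp_add_right {C : ℝ}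
    {u : ℝ → EuclideanSpace ℝ (Fin 3) → EuclideanSpace ℝ (Fin 3)} (h : IsTypeIAncientMild C u)
    (c : EuclideanSpace ℝ (Fin 3)) : IsTypeIAncientMild C (fun t x => u t (x + c)) := by
  refine ⟨?_, fun t ht => (h.isDivFree ht).comp_add_right c, fun s t hst ht x => ?_,
    fun t ht x => h.norm_le ht (x + c)⟩
  · have e : (uncurry fun t x => u t (x + c)) =
        uncurry u ∘ fun p : ℝ × EuclideanSpace ℝ (Fin 3) => (p.1, p.2 + c) := by
      funext p
      rfl
    rw [e]
    refine h.contDiffOn.comp ((contDiff_fst.prodMk (contDiff_snd.add contDiff_const)).contDiffOn) ?_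
    intro p hp
    exact mem_prod.2 ⟨(mem_prod.1 hp).1, mem_univ _⟩
  · show u t (x + c) = heatFlow (fun y => u s (y + c)) (t - s) x -
        oseenDuhamel 1 s (fun τ y => u τ (y + c)) (fun τ y => u τ (y + c)) t x
    rw [heatFlow_comp_add_right, oseenDuhamel_comp_add_right]
    exact h.mild_eq hst ht (x + c)

/-- For `σ ≠ 0` and `A` skew, `σ + A` is invertible (`⟪(σ + A)v, v⟫ = σ‖v‖²`): the spiral scaling
`ξ = (a, σ, A)` has a centre `c`, `σc + Ac = −a`.  (Same helper as in the sibling line.) -/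
theorem exists_spiral_centre {σ : ℝ} (hσ : σ ≠ 0)
    {A : EuclideanSpace ℝ (Fin 3) →L[ℝ] EuclideanSpace ℝ (Fin 3)} (hA : ∀ x, inner ℝ (A x) x = 0)
    (a : EuclideanSpace ℝ (Fin 3)) : ∃ c : EuclideanSpace ℝ (Fin 3), σ • c + A c = -a := by
  let M : EuclideanSpace ℝ (Fin 3) →ₗ[ℝ] EuclideanSpace ℝ (Fin 3) :=
    σ • LinearMap.id + (A : EuclideanSpace ℝ (Fin 3) →ₗ[ℝ] EuclideanSpace ℝ (Fin 3))
  have hM : ∀ v, M v = σ • v + A v := fun v => rfl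
  have hinj : Function.Injective M := by
    intro v w hvw
    have h0 : M (v - w) = 0 := by rw [map_sub, hvw, sub_self]
    rw [hM] at h0
    have h1 : inner ℝ (σ • (v - w) + A (v - w)) (v - w) = 0 := by rw [h0, inner_zero_left]
    rw [inner_add_left, hA (v - w), add_zero, real_inner_smul_left, real_inner_self_eq_norm_sq] at h1
    have h2 : ‖v - w‖ ^ 2 = 0 := by
      rcases mul_eq_zero.1 h1 with h | h
      · exact absurd h hσ
      · exact h
    have h3 : v - w = 0 := by
      rw [← norm_eq_zero]
      exact pow_eq_zero_iff two_ne_zero |>.1 h2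
    exact sub_eq_zero.1 h3
  obtain ⟨c, hc⟩ := (LinearMap.injective_iff_surjective.1 hinj) (-a)
  exact ⟨c, by rw [← hM]; exact hc⟩

/-- **Skew geometry**: for `A` skew, `x ⊥ Ax`, so `‖x + Ax‖² = ‖x‖² + ‖Ax‖²` and in particular `‖x‖ ≤ ‖x + Ax‖`
— the paraboloid `‖x‖ ≥ R√(−t)` lies inside stub 2's far region for `ξ = (0, 1, A)` once `R ≥ ρ(1 + ‖A‖)`. -/
theorem norm_le_norm_add_of_skew
    {A : EuclideanSpace ℝ (Fin 3) →L[ℝ] EuclideanSpace ℝ (Fin 3)} (hA : ∀ x, inner ℝ (A x) x = 0)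
    (x : EuclideanSpace ℝ (Fin 3)) : ‖x‖ ≤ ‖x + A x‖ := by
  have h0 : inner ℝ x (A x) = 0 := by
    rw [real_inner_comm (A x) x]
    exact hA x
  have h1 : ‖x + A x‖ ^ 2 = ‖x‖ ^ 2 + ‖A x‖ ^ 2 := by
    rw [norm_add_sq_real, h0]
    ring
  have h2 : ‖x‖ ^ 2 ≤ ‖x + A x‖ ^ 2 := by
    rw [h1]
    exact le_add_of_nonneg_right (sq_nonneg _)
  exact (sq_le_sq₀ (norm_nonneg _) (norm_nonneg _)).1 h2

/-! ## Backward ends versus the whole past (sorry-free) -/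

/-- **End-to-past reduction for Killing symmetries.** If every `v ∈ A_C` annihilated on the whole past by the
time-independent generator `b·∇ − A` vanishes, then every `u ∈ A_C` annihilated by it on a backward end `t < θ`
(`θ ≤ 0`) vanishes on that end (apply the hypothesis to `v = u(· + θ) ∈ A_C`, `IsTypeIAncientMild.comp_sub_right`).
(Same helper as in the sibling line.) -/
theorem vanishesOnEnd_of_vanishesOnPast {C : ℝ}
    {u : ℝ → EuclideanSpace ℝ (Fin 3) → EuclideanSpace ℝ (Fin 3)} (hcl : IsTypeIAncientMild C u)
    {θ : ℝ} (hθ : θ ≤ 0)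
    (b : EuclideanSpace ℝ (Fin 3) → EuclideanSpace ℝ (Fin 3))
    (A : EuclideanSpace ℝ (Fin 3) →L[ℝ] EuclideanSpace ℝ (Fin 3))
    (hsym : ∀ t < θ, ∀ x, fderiv ℝ (u t) x (b x) - A (u t x) = 0)
    (hpast : ∀ v : ℝ → EuclideanSpace ℝ (Fin 3) → EuclideanSpace ℝ (Fin 3), IsTypeIAncientMild C v →
      (∀ t < 0, ∀ x, fderiv ℝ (v t) x (b x) - A (v t x) = 0) → ∀ t < 0, ∀ x, v t x = 0) :
    ∀ t < θ, ∀ x, u t x = 0 := by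
  intro t ht x
  have hv : IsTypeIAncientMild C (fun s => u (s - -θ)) := hcl.comp_sub_right (by linarith)
  have hsv : ∀ s < 0, ∀ y,
      fderiv ℝ ((fun s => u (s - -θ)) s) y (b y) - A ((fun s => u (s - -θ)) s y) = 0 := by
    intro s hs y
    exact hsym (s - -θ) (by linarith) y
  have key := hpast (fun s => u (s - -θ)) hv hsv (t - θ) (by linarith) x
  have e : t - θ - -θ = t := by ring
  simpa only [e] using key

/-! ## The composition (sorry-free) -/

/-- **The rotation leaf about an axis through the origin, from stubs 2 → 3 → 4** (B1 at `σ = 0` feeds the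
axis bootstrap, whose rate feeds KNSS 5.3): `u ∈ A_C`, `∇u·Ax − Au = 0` with `A ≠ 0` skew ⇒ `u ≡ 0`. -/
theorem rotationLeaf_of_stubs (C : ℝ) (u : ℝ → EuclideanSpace ℝ (Fin 3) → EuclideanSpace ℝ (Fin 3))
    (A : EuclideanSpace ℝ (Fin 3) →L[ℝ] EuclideanSpace ℝ (Fin 3))
    (hcl : IsTypeIAncientMild C u) (hA : ∀ x, inner ℝ (A x) x = 0) (hA0 : A ≠ 0)
    (hsym : ∀ t < 0, ∀ x, fderiv ℝ (u t) x (A x) - A (u t x) = 0) :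
    ∀ t < 0, ∀ x, u t x = 0 := by
  -- B1 with `σ = 0`: smallness outside parabolic tubes around `ker A`
  have hfar : ∀ ε > 0, ∃ R : ℝ, ∀ t < 0, ∀ x, R * Real.sqrt (-t) * ‖A‖ ≤ ‖A x‖ →
      Real.sqrt (-t) * ‖u t x‖ ≤ ε := by
    intro ε hε
    obtain ⟨ρ, hρ⟩ := stub_farFieldVanishing C ε hε
    refine ⟨ρ, fun t ht x hx => hρ u 0 A hcl hA (fun h => hA0 h.2) ?_ t ht x ?_⟩
    · intro t ht x
      simpa only [zero_smul, zero_add, add_zero, mul_zero, zero_mul] using hsym t ht x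
    · simpa only [abs_zero, zero_add, zero_smul] using hx
  -- B2 (axis): the critical rate `dist · ‖u‖ ≤ K`
  obtain ⟨K, hK⟩ := stub_axisOseenBootstrap C u A hcl hA hA0 hfar
  -- KNSS Thm 5.3 in the gauge class
  exact stub_axisymmetricLeafOfRate C K u A hcl hA hA0 hsym hK

/-- The rotation leaf about the axis through an arbitrary point `c` (conjugate by the translation `x ↦ x + c`,
`isTypeIAncientMild_comp_add_right`). -/
theorem rotationLeafAbout_of_stubs {C : ℝ} {u : ℝ → EuclideanSpace ℝ (Fin 3) → EuclideanSpace ℝ (Fin 3)}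
    (hcl : IsTypeIAncientMild C u) (c : EuclideanSpace ℝ (Fin 3))
    (A : EuclideanSpace ℝ (Fin 3) →L[ℝ] EuclideanSpace ℝ (Fin 3))
    (hA : ∀ x, inner ℝ (A x) x = 0) (hA0 : A ≠ 0)
    (hsym : ∀ t < 0, ∀ x, fderiv ℝ (u t) x (A (x - c)) - A (u t x) = 0) :
    ∀ t < 0, ∀ x, u t x = 0 := by
  have hv : IsTypeIAncientMild C (fun t x => u t (x + c)) := isTypeIAncientMild_comp_add_right hcl c
  have hsv : ∀ t < 0, ∀ y,
      fderiv ℝ ((fun t x => u t (x + c)) t) y (A y) - A ((fun t x => u t (x + c)) t y) = 0 := by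
    intro t ht y
    have e2 : fderiv ℝ (fun x => u t (x + c)) y = fderiv ℝ (u t) (y + c) := by
      rw [fderiv_comp_add_right]
    have key := hsym t ht (y + c)
    rw [add_sub_cancel_right] at key
    show fderiv ℝ (fun x => u t (x + c)) y (A y) - A (u t (y + c)) = 0
    rw [e2]
    exact key
  intro t ht x
  have key := rotationLeaf_of_stubs C (fun t x => u t (x + c)) A hv hA hA0 hsv t ht (x - c)
  simpa only [sub_add_cancel] using key

/-- **BONUS — the route item `AxisymEndLiouville` (stmt-NavierStokesRegularity-14061, crux r4 of the route) BY
NAME from stubs 2, 3, 4**: the axisymmetric leaf on a backward end, swirl allowed, any axis, closes on the PROVED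
KNSS 5.3 once the far-field recentring and the axis bootstrap land (end-to-past reduction + translation of the
axis + `rotationLeaf_of_stubs`).  So building this line also closes item 14061. -/
theorem axisymEndLiouville_of : AxisymEndLiouville := by
  intro C u hcl c A θ hA hA0 hθ hsym
  exact vanishesOnEnd_of_vanishesOnPast hcl hθ (fun x => A (x - c)) A hsym
    (fun v hv hsv => rotationLeafAbout_of_stubs hv c A hA hA0 hsv)

/-- **The skeleton concludes the crux BY NAME**: `SymmetricLiouville` (route `SymmetryModuliCount`,
stmt-NavierStokesRegularity-4053) from the six registered stubs and the route's own Killing item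
`HelicalEndLiouville` (stmt-14062; translation / nonzero-pitch screw leaf, staffed on its own rank and owned by
the sibling merge group blowdown-kills-pitch ≈ screw-lattice-blowdown ≈ degenerate-stabiliser-zoom §H).
Conjugacy bookkeeping done here, sorry-free: `σ = 0` ⇒ Killing generator `(a, A)`, split on `a ∈ range A`
(rotation about the axis through `−c`, `a = Ac`: `axisymEndLiouville_of` at `θ = 0`, i.e. stubs 2 → 3 → 4) versus
`a ∉ range A` (`hH` at `θ = 0`); `σ ≠ 0` ⇒ translate to the centre of the spiral scaling (`exists_spiral_centre`,
`isTypeIAncientMild_comp_add_right`), divide the generator by `σ`, split on `A/σ = 0` (stub 6, Tsai) versus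
`A/σ ≠ 0` (stub 2 at `σ = 1` ⇒ smallness outside paraboloids, `norm_le_norm_add_of_skew` ⇒ stub 5 ⇒ stub 7). -/
theorem SymmetricLiouville_of (hH : HelicalEndLiouville) : SymmetricLiouville := by
  intro C u hu a σ A hA hne hL t ht x
  have hcl : IsTypeIAncientMild C u := isTypeIAncientMild_iff.2 hu
  rcases eq_or_ne σ 0 with rfl | hσ
  · -- ISOMETRIC (Killing) leaves: `L_ξ u = ∇u·(a + Ax) − Au`
    have hK : ∀ t < 0, ∀ x, fderiv ℝ (u t) x (a + A x) - A (u t x) = 0 := by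
      intro t ht x
      have h1 := hL t ht x
      simp only [zero_smul, add_zero, mul_zero, zero_mul] at h1
      exact h1
    by_cases hra : a ∈ Set.range A
    · -- rotation about the axis through `-c`: stubs 2 → 3 → 4 (via the bonus item proof) at `θ = 0`
      obtain ⟨c, hc⟩ := hra
      have hA0 : A ≠ 0 := by
        rintro rfl
        apply hne
        refine ⟨?_, rfl, rfl⟩
        rw [← hc, zero_apply]
      refine axisymEndLiouville_of C u hcl (-c) A 0 hA hA0 le_rfl ?_ t ht x
      intro t ht x
      have e : A (x - -c) = a + A x := by
        rw [sub_neg_eq_add, map_add, hc, add_comm]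
      rw [e]
      exact hK t ht x
    · -- translation or screw of nonzero pitch: the route item `HelicalEndLiouville` at `θ = 0`
      exact hH C u hcl a A 0 hA hra le_rfl hK t ht x
  · -- SPIRAL SCALINGS `σ ≠ 0`: translate to the centre, normalise the rate to `1`
    obtain ⟨c, hc⟩ := exists_spiral_centre hσ hA a
    have hv : IsTypeIAncientMild C (fun t x => u t (x + c)) := isTypeIAncientMild_comp_add_right hcl c
    obtain ⟨A', hA'def⟩ :
        ∃ A' : EuclideanSpace ℝ (Fin 3) →L[ℝ] EuclideanSpace ℝ (Fin 3), A' = σ⁻¹ • A := ⟨_, rfl⟩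
    have hA' : ∀ x, inner ℝ (A' x) x = 0 := by
      intro x
      rw [hA'def, smul_apply, real_inner_smul_left, hA x, mul_zero]
    -- the normalised symmetry of the translated field
    have hLv : ∀ t < 0, ∀ x, fderiv ℝ (fun y => u t (y + c)) x (x + A' x) + u t (x + c) +
        (2 * t) • timeDeriv (fun s y => u s (y + c)) t x - A' (u t (x + c)) = 0 := by
      intro t ht x
      have key := hL t ht (x + c)
      have e1 : a + σ • (x + c) + A (x + c) = σ • x + A x := by
        have h0 : σ • c + A c + a = 0 := by rw [hc, neg_add_cancel]
        calc a + σ • (x + c) + A (x + c) = σ • x + A x + (σ • c + A c + a) := by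
              rw [smul_add, map_add]; abel
          _ = σ • x + A x := by rw [h0, add_zero]
      rw [e1] at key
      have e2 : fderiv ℝ (fun y => u t (y + c)) x = fderiv ℝ (u t) (x + c) := by
        rw [fderiv_comp_add_right]
      have e3 : timeDeriv (fun s y => u s (y + c)) t x = timeDeriv u t (x + c) := rfl
      rw [e2, e3]
      have k2 := congrArg (fun w => σ⁻¹ • w) key
      simp only [smul_zero, smul_add, smul_sub, smul_smul, inv_mul_cancel₀ hσ, one_smul] at k2
      have e5 : σ⁻¹ * (2 * σ * t) = 2 * t := by
        rw [mul_comm 2 σ, mul_assoc, inv_mul_cancel_left₀ hσ]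
      have e6 : σ⁻¹ • fderiv ℝ (u t) (x + c) (σ • x + A x) = fderiv ℝ (u t) (x + c) (x + A' x) := by
        rw [← (fderiv ℝ (u t) (x + c)).map_smul]
        congr 1
        rw [hA'def, smul_apply, smul_add, smul_smul, inv_mul_cancel₀ hσ, one_smul]
      have e7 : σ⁻¹ • A (u t (x + c)) = A' (u t (x + c)) := by
        rw [hA'def, smul_apply]
      rw [e5, e6, e7] at k2
      exact k2
    -- conclude on the translated field, then translate back
    suffices hzero : ∀ t < 0, ∀ x, (fun t x => u t (x + c)) t x = 0 by
      have := hzero t ht (x - c)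
      simpa only [sub_add_cancel] using this
    rcases eq_or_ne A' 0 with hA0 | hA0
    · -- pure scaling: Tsai leaf (stub 6)
      refine stub_selfSimilarLeaf C (fun t x => u t (x + c)) hv ?_
      intro t ht x
      have h1 := hLv t ht x
      rw [hA0] at h1
      simp only [zero_apply, add_zero, sub_zero] at h1
      exact h1
    · -- rotated scaling: far-field vanishing (stub 2 at σ = 1) ⇒ smallness outside paraboloids ⇒
      -- space–time Type I (stub 5) ⇒ RSS Liouville in the decaying class (stub 7)
      have hfar : ∀ ε > 0, ∃ R : ℝ, ∀ t < 0, ∀ x, R * Real.sqrt (-t) ≤ ‖x‖ →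
          Real.sqrt (-t) * ‖(fun t x => u t (x + c)) t x‖ ≤ ε := by
        intro ε hε
        obtain ⟨ρ, hρ⟩ := stub_farFieldVanishing C ε hε
        refine ⟨ρ * (1 + ‖A'‖), fun t ht x hx =>
          hρ (fun t x => u t (x + c)) 1 A' hv hA' (fun h => one_ne_zero h.1) ?_ t ht x ?_⟩
        · intro t ht x
          have h1 := hLv t ht x
          show fderiv ℝ (fun y => u t (y + c)) x ((1 : ℝ) • x + A' x) + (1 : ℝ) • u t (x + c) +
            (2 * 1 * t) • timeDeriv (fun s y => u s (y + c)) t x - A' (u t (x + c)) = 0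
          rw [one_smul, one_smul, mul_one]
          exact h1
        · calc ρ * Real.sqrt (-t) * (|1| + ‖A'‖) = ρ * (1 + ‖A'‖) * Real.sqrt (-t) := by
                rw [abs_one]; ring
            _ ≤ ‖x‖ := hx
            _ ≤ ‖x + A' x‖ := norm_le_norm_add_of_skew hA' x
            _ = ‖(1 : ℝ) • x + A' x‖ := by rw [one_smul]
      obtain ⟨K, hK⟩ := stub_oseenBootstrap C (fun t x => u t (x + c)) hv hfar
      exact stub_rotatedSelfSimilarDecayingLiouville C K (fun t x => u t (x + c)) A' hv hK hA' hA0 hLv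

end Summit.NavierStokesRegularity.NavierStokesRegularity.Cruxes.SymmetricLiouville.FarfieldRecentringCriticalRate

end
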